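import Literature.MathematicalPhysics.QuantumFieldTheory.Balaban1983to89.Node00.TkNoExpansionAtTheta13
import Literature.MathematicalPhysics.QuantumFieldTheory.Balaban1983to89.Node00.Record12ResidualsSlots
import Literature.MathematicalPhysics.QuantumFieldTheory.Balaban1983to89.T4AxialGaugeFixing
import Summits.QuantumFields.YangMills.Theorems.BalabanUVNodesK0BgProvisoRangedAtEmptySeq

/-!
# DAG node N11 — the FIRST instance of (S1ᵀ)₁₃ IS TERM-FREE at the all-large-field new sequence: there the renormalized action (2.23) of record
# COLLAPSES to the bare Wilson action, `A_1(s′)(U) = −g₀⁻²·A(U) − E_1(s′)` for EVERY term-value witness, so at any Stage-13 `θ` carrying K0b's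
# residual 𝐓-weights the level-1 coherence equation reads `∫dU δ(ŪV₁⁻¹) w(s′)(U,V₁)ρ₀(U) =ᵐ (#{Y})⁻¹e^{E−E_1(s′)} ∫dU δ(ŪV₁⁻¹) 𝟙{U regular}ρ₀(U)`
# — a NECESSARY CONDITION on the witness's weights ALONE (def-T's `w` against p. 256's `χreg` under the block-averaging disintegration), no 𝐄-term left

Cell `pub-ymgap`, YM-PLAN Track A (HUMAN RULING D-0062), seat `pub-ymgap-dag-n11-d` (g4; R134 fan-out seat N11 [B14], strategy s2), route `BalabanUVNodes`
rev 16∕17, item K1‴ `StabilityBAtRecordR13e` = stmt-QuantumFields-19910.  [III] = [Balaban1988Convergent], [I] = [Balaban1987RG1].  Sequel of this seat's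
`Node00.TkNoExpansionAtTheta13` (p491789: the closed form `(#{Y})⁻¹·χreg_0(T)·e^{A_1(s′)}` of the right-hand integrand at `θ.Zt = ZtOfRecord`) over r11's
`B14.Eq225Concrete` ((2.23)–(2.25) with body; the telescoping `smearedWilson_invSq_telescope`), 11b's ranges `Sect2.admE ∕ admR ∕ admB` and seat dag-n21-c's
`BalabanUVNodesK0BgProvisoRangedAtEmptySeq.domSites_nonempty`.

WHY THIS FILE.  N11's residue at the rev-16 record is (S1ᵀ)₁₃ (`BalabanUVNodesN11AtRecord13C`); its first instance `TLaw₁₃ θ P 0` demands, at the new sequence `s′`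
WITHOUT small-field region (`Ω₁(s′) = Λ₁(s′) = ∅`), the (3.25) identity as an equation between two one-step transports (`TkNoExpansionAtRecord13`,
`…AtTheta13`).  The right side there still displayed the symbolic action `A_1(s′)(U)` of the witness's term values `(t, E_1)`.  HERE that action is COMPUTED:
along `s′` every range of (2.23) is EMPTY at scale 1 — (2.26)∕(2.27) `admE` needs `z ∈ X ⊆ Λ₁ = ∅`, (2.30) `admR` needs `X ⊆ Λ₁^{∼−1} ⊆ Λ₁ = ∅` (a domain has a
site, `M ≥ 1`), (2.41)(i) `admB` needs `X ∩ Ω₁ ≠ ∅` — so `𝐄_1 = −β₁(g₀)A(φ₁, U)`, `𝐑_1 = 𝐁_1 = 0`, and by (2.24)'s telescoping `A(1∕g_1²(·), U) + β₁(g₀)A(φ₁, U) =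
g₀⁻²A(U)`: `A_1(s′)(U) = −g₀⁻²A(U) − E_1(s′)` FOR EVERY `t` (§1, at ANY setting ∕ residual ∕ sequence of record).  Hence `e^{A_1(s′)(U)} = e^{E − E_1(s′)}·ρ₀(U)`
(§2) and, at a `θ` with `θ.Zt = ZtOfRecord` under the letters' junction, the no-expansion integrand is `(#{Y})⁻¹·χreg_0(T)(U,V₁)·e^{E−E_1(s′)}·ρ₀(U)` (§3) — the
term values have DROPPED OUT: what (S1ᵀ)₁₃,₀ demands of the witness at `s′` is a property of def-T's step weights `w(s′)`, p. 256's regularity cut `χreg`, the Wilson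
start `ρ₀` and ONE constant.  §4 states it: under `TLaw₁₃ θ p 0`, for some constant `E_1`, `slotT_1(s′) ≡ 0` or
`T[w(s′)(·,V₁)·ρ₀] =ᵐ T[(#{Y})⁻¹·e^{E−E_1}·χreg_0(T)(·,V₁)·ρ₀]` (NO displayed proviso left but the junction, `M ≥ 1`, `0 < K`: the joint measurability ∕ bound of
`χreg·ρ₀` that `…AtTheta13` displayed are DISCHARGED here, `measurable_chiRegW_pairCfg_mul`, `abs_chiRegW_pairCfg_mul_rhoZero_le`) — by transport duality, «the conditional
expectation `E[ρ₀·(w(s′) − c·χreg) | Ū = V₁]` vanishes a.s.»: the (3.2) large-field weights of `V₁` inside `w(s′)` against an indicator that reads `U` only.  This is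
the sharpest form of dag-n11-d g2's reading (ii) (pub-ymgap INBOX l.14524): at the K0‴ witnesses of record (`Zt := ZtOfRecord`), K1‴'s N11 conjunct is decided
at its first step by a weights-only equation no choice of [III]'s 𝐄-terms can influence — the located reason a `Zt` re-pin (ζ0 carrying the step weights'
large-field factor, allowed by `ztLocal`) is the door, not a term adjustment.

WHAT THIS FILE PROVES (0 `sorry`, 0 `def`, standard axioms; `N`-generic).  §1 `admE_eq_false_of_Λ_empty`, `admR_eq_false_of_Λ_empty` (`M ≥ 1`),
`admB_eq_false_of_Ω_empty`, `E225_of_forall_Λ_empty`, `R230_of_forall_Λ_empty`, `B240_of_forall_Ω_empty`, **`action23_of_forall_Omega_empty`** (generic: ANY length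
`n` with `Ω_j = ∅` for all `1 ≤ j ≤ n` — the whole all-large-field HISTORY —, any §2 setting, residual, term values, fluctuation argument, constant: `A_n(U) =
−g₀⁻²A(U) − E_n`), `action23_one_of_Omega_empty` (the first step).  §2 `exp_action23_one_eq_rhoZero_of_Omega_empty₁₃` (at the Stage-13 setting of record:
`e^{A_1(s′)(U)} = e^{E(p) − E_1}·ρ₀(U)`).  §3 **`noExpIntegrand_termFree_of_Zt_eq_ZtOfRecord`** (the term-free closed form).  §4
`measurable_chiRegW_pairCfg_mul`, `abs_chiRegW_pairCfg_mul_rhoZero_le` (the two provisos `…AtTheta13` displayed, discharged),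
**`tLaw₁₃_zero_termFree_of_Zt_eq_ZtOfRecord`** (the weights-only necessary condition, from `TLaw₁₃ θ p 0` itself; hypotheses: `θ.Zt = ZtOfRecord`, junction, `M ≥ 1`,
`0 < K`) and its instances `tLaw₁₃_zero_termFree_theta13LiveOfFamily` ∕ `…_theta13LiveOfRecord` at K0a's witnesses (hypotheses: `0 ≤ g₀`, `0 < K`, `TLaw₁₃` ONLY).
§5 (the same at an ARBITRARY `Zt`, term-free, supported on the regular fine fields) is the sequel file `…NoExpansionTermFreeAnyWeights`.

HONEST FRAMING.  Count-neutral kernel bookkeeping on the tree's OWN objects (r11's (2.23)–(2.25) with body, 11b's printed ranges, 12a∕12b∕K0b's weights); a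
NECESSARY-CONDITION READING of (S1ᵀ)₁₃ at the K0‴ witnesses — NOT a proof that it holds or fails there (deciding the weights-only equation needs positivity ∕
quantitative facts about the block-averaging fibres of the (3.2) regions that the tree does not have), NOT a refutation of K1‴, nothing of Bałaban's asserted or
refuted ([III]'s 𝐓 carries ONE family of weights where the tree carries two — def-T's `w` and 12a's `Zt` — which is the located source of the condition).  N11 NOT
discharged; counts unmoved (typed 28∕28 · discharged 5∕28).  One finite four-torus programme at fixed `ε = L^{−K}`; NOT ℝ⁴, NOT OS, NOT a mass gap, NOT Clay.
Sources: [III] (2.23)–(2.27) pp. 258–259, (2.30) p. 260, (2.40)–(2.41) p. 261, (2.10) p. 256, (2.21)–(2.22) p. 258, (3.1)–(3.2) pp. 264–265, (3.16) p. 268,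
(3.25) p. 270, Theorem p. 245, Thm 1 p. 262; [I] (1.27) p. 253.
-/

noncomputable section

open MeasureTheory
open scoped BigOperators Matrix.Norms.L2Operator

namespace Summit.QuantumFields.YangMills.Theorems.BalabanUVNodesN11NoExpansionTermFree

open Literature.MathematicalPhysics.QuantumFieldTheory.Balaban1983to89 T4Continuum Node00 Node00.Tk DagBinding
open Summit.QuantumFields.YangMills.Theorems.K0BgProvisoOverRange (domSites_nonempty)

variable {F : T4Family} {N : ℕ} [NeZero N]

/-! ## §1. GENERIC: along a sequence whose regions are ALL EMPTY up to its length, every range of (2.23) is empty; the action collapses to `−g₀⁻²A(U) − E` -/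

section Generic

variable {𝔸 : Type*} [NormedRing 𝔸] [NormedAlgebra ℂ 𝔸] [CompleteSpace 𝔸] {V : Type*}
variable {ν : Stage7Numerics} {M : ℕ} {g : ℕ → ℝ} {K n : ℕ}

/-- **(2.26)∕(2.27)'s RANGE IS EMPTY AT A SCALE `j` WITH `Λ_j = ∅`**: `admE` asks `z ∈ X ⊆ Λ_j`. [cite: Balaban1988Convergent, (2.26)–(2.27) p.259] -/
theorem admE_eq_false_of_Λ_empty (s : SeqOfRecord F ν M g K n) {j : ℕ} (hΛ : s.Λ j = ∅) (Y : Set (Site (F.P K) 0)) (z : Site (F.P K) j) :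
    Sect2.admE (F.P K) ν M g s.Λ j Y z = false := by
  rw [Sect2.admE, decide_eq_false_iff_not, hΛ]
  rintro ⟨-, hz, hsub⟩
  exact absurd (hsub hz) (Set.notMem_empty _)

/-- **(2.30)'s RANGE IS EMPTY AT A SCALE `j` WITH `Λ_j = ∅`** (`M ≥ 1`: a localization domain has a site, dag-n21-c's `domSites_nonempty`): `admR` asks
`X ⊆ Λ_j^{∼−1} ⊆ Λ_j`. [cite: Balaban1988Convergent, (2.30) p.260] -/
theorem admR_eq_false_of_Λ_empty (hM : 1 ≤ M) (s : SeqOfRecord F ν M g K n) {j : ℕ} (hΛ : s.Λ j = ∅) (X : (Sect2.domSys (F.P K) M j).Dom) :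
    Sect2.admR (F.P K) ν M g s.Λ j (Sect2.domSites (F.P K) M j X) = false := by
  rw [Sect2.admR, decide_eq_false_iff_not, hΛ]
  intro hsub
  obtain ⟨y, hy⟩ := domSites_nonempty (P := F.P K) hM j X
  have hy' := hsub hy
  simp only [Sect2.innerT, Set.preimage_empty, Set.mem_image] at hy'
  obtain ⟨x, hx, -⟩ := hy'
  exact absurd hx.1 (Set.notMem_empty _)

/-- **(2.41)(i)'s RANGE IS EMPTY AT A SCALE `j` WITH `Ω_j = ∅`**: `admB` asks `X ∩ Ω_j ≠ ∅`. [cite: Balaban1988Convergent, (2.41)(i) p.261] -/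
theorem admB_eq_false_of_Ω_empty (s : SeqOfRecord F ν M g K n) {j : ℕ} (hΩ : s.Ω j = ∅) (Y : Set (Site (F.P K) 0)) :
    Sect2.admB (F.P K) ν M g s.Ω s.Λ j Y = false := by
  rw [Sect2.admB, decide_eq_false_iff_not, hΩ]
  rintro ⟨⟨x, hx⟩, -⟩
  exact absurd hx.2 (Set.notMem_empty _)

variable (S : Sect2.Setting 𝔸 (SU N)) (Rz : Sect2.Residual (F.P K) 𝔸)

/-- **`𝐄_n = −Σ_{j ≤ n} β_j(g_{j−1})·A(φ_j, U)` along a sequence with `Λ_j = ∅` for `1 ≤ j ≤ n`** — (2.25) with body: every vacuum-subtracted 𝐄-sum is empty, the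
coupling-renormalization counterterms remain. [cite: Balaban1988Convergent, (2.25)–(2.27) p.259] -/
theorem E225_of_forall_Λ_empty (s : SeqOfRecord F ν M g K n) (hΛ : ∀ j, 1 ≤ j → j ≤ n → s.Λ j = ∅) (t : Sect2.TermValues (F.P K) 𝔸 V M)
    (U : GaugeField (F.P K) 0 (SU N)) :
    B14.Eq225Concrete.E225 (Sect2.towerOfTerms S Rz M s.Ω t) (fun j X z => Sect2.admE (F.P K) ν M g s.Λ j (Sect2.domSites (F.P K) M j X) z) Rz.phi n U =
      -(∑ j ∈ Finset.Icc 1 n, S.flow.β j (S.flow.g (j - 1)) * B14.Eq225Concrete.smearedWilson (Rz.phi j) U) := by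
  unfold B14.Eq225Concrete.E225
  rw [← Finset.sum_neg_distrib]
  refine Finset.sum_congr rfl fun j hj => ?_
  rw [Finset.mem_Icc] at hj
  have h0 : B14.Eq225Concrete.EjSub (Sect2.towerOfTerms S Rz M s.Ω t)
      (fun j X z => Sect2.admE (F.P K) ν M g s.Λ j (Sect2.domSites (F.P K) M j X) z) j U = 0 := by
    unfold B14.Eq225Concrete.EjSub
    simp only [admE_eq_false_of_Λ_empty s (hΛ j hj.1 hj.2), Bool.false_eq_true, if_false, Finset.sum_const_zero]
  rw [h0, zero_sub]
  rfl

/-- **`𝐑_n = 0` along such a sequence** (`M ≥ 1`). [cite: Balaban1988Convergent, (2.30) p.260] -/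
theorem R230_of_forall_Λ_empty (hM : 1 ≤ M) (s : SeqOfRecord F ν M g K n) (hΛ : ∀ j, 1 ≤ j → j ≤ n → s.Λ j = ∅)
    (t : Sect2.TermValues (F.P K) 𝔸 V M) (U : GaugeField (F.P K) 0 (SU N)) :
    B14.Eq225Concrete.R230 (Sect2.towerOfTerms S Rz M s.Ω t) (fun j X => Sect2.admR (F.P K) ν M g s.Λ j (Sect2.domSites (F.P K) M j X)) n U = 0 := by
  unfold B14.Eq225Concrete.R230
  refine Finset.sum_eq_zero fun j hj => Finset.sum_eq_zero fun X _ => ?_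
  rw [Finset.mem_Icc] at hj
  have h := admR_eq_false_of_Λ_empty hM s (hΛ j hj.1 hj.2) X
  simp only [Sect2.towerOfTerms] at h ⊢
  rw [h]
  simp

/-- **`𝐁_n = 0` along a sequence with `Ω_j = ∅` for `1 ≤ j ≤ n`.** [cite: Balaban1988Convergent, (2.40)–(2.41) p.261] -/
theorem B240_of_forall_Ω_empty (s : SeqOfRecord F ν M g K n) (hΩ : ∀ j, 1 ≤ j → j ≤ n → s.Ω j = ∅) (t : Sect2.TermValues (F.P K) 𝔸 V M)
    (a : Tk.SFluct (F.P K) V) (U : GaugeField (F.P K) 0 (SU N)) :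
    B14.Eq225Concrete.B240 (Sect2.towerOfTerms S Rz M s.Ω t) (fun j X => Sect2.admB (F.P K) ν M g s.Ω s.Λ j (Sect2.domSites (F.P K) M j X)) a n U = 0 := by
  unfold B14.Eq225Concrete.B240
  refine Finset.sum_eq_zero fun j hj => Finset.sum_eq_zero fun X _ => ?_
  rw [Finset.mem_Icc] at hj
  have h := admB_eq_false_of_Ω_empty s (hΩ j hj.1 hj.2) (Sect2.domSites (F.P K) M j X)
  simp only [Sect2.towerOfTerms] at h ⊢
  rw [h]
  simp

/-- **THE RENORMALIZED ACTION (2.23) ALONG THE ALL-LARGE-FIELD HISTORY IS THE BARE WILSON ACTION**: for a sequence of length `n` with `Ω_j = ∅` (hence `Λ_j = ∅`)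
for every `1 ≤ j ≤ n`, and for EVERY §2 setting, residual, term-value witness, fluctuation argument and constant, `A_n(s)(U) = −g₀⁻²·A(U) − E_n` (`M ≥ 1`) — all
three term sums have empty ranges at every scale and (2.24) telescopes `A(1∕g_n²(·), U) + Σ_{j ≤ n} β_j(g_{j−1})A(φ_j, U) = g₀⁻²A(U)` (r11's
`smearedWilson_invSq_telescope`).  THE 𝐄-TERMS DROP OUT. [cite: Balaban1988Convergent, (2.23)–(2.27) pp.258–259, (2.30) p.260, (2.40)–(2.41) p.261; Balaban1987RG1, (1.27) p.253] -/
theorem action23_of_forall_Omega_empty (hM : 1 ≤ M) (s : SeqOfRecord F ν M g K n) (hΩ : ∀ j, 1 ≤ j → j ≤ n → s.Ω j = ∅)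
    (t : Sect2.TermValues (F.P K) 𝔸 V M) (a : Tk.SFluct (F.P K) V) (Ek : ℝ) (U : GaugeField (F.P K) 0 (SU N)) :
    (sect2ActionDataOfRecord F N V K S Rz s t a Ek).action23 n U = -(1 / (S.flow.g 0) ^ 2 * wilsonAction4 U) - Ek := by
  have hΛ : ∀ j, 1 ≤ j → j ≤ n → s.Λ j = ∅ := fun j h1 h2 => seq_Λ_eq_empty_of_Ω_eq_empty s (hΩ j h1 h2)
  show (Sect2.actionDataOfTerms S Rz ν M g s.Ω s.Λ t n a Ek).action23 n U = _
  rw [Sect2.action23_actionDataOfTerms, E225_of_forall_Λ_empty S Rz s hΛ t U, R230_of_forall_Λ_empty S Rz hM s hΛ t U,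
    B240_of_forall_Ω_empty S Rz s hΩ t a U]
  have htel := B14.Eq225Concrete.smearedWilson_invSq_telescope S.flow Rz.phi U n
  rw [B14.Eq225Concrete.smearedWilson_invSq_zero] at htel
  linarith

/-- **IN PARTICULAR AT THE FIRST STEP** (a length-1 sequence with `Ω₁ = ∅`): `A_1(s′)(U) = −g₀⁻²·A(U) − E_1` for every term-value witness.
[cite: Balaban1988Convergent, (2.23)–(2.25) pp.258–259; Balaban1987RG1, (1.27) p.253] -/
theorem action23_one_of_Omega_empty (hM : 1 ≤ M) (s : SeqOfRecord F ν M g K 1) (hΩ : s.Ω 1 = ∅) (t : Sect2.TermValues (F.P K) 𝔸 V M)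
    (a : Tk.SFluct (F.P K) V) (Ek : ℝ) (U : GaugeField (F.P K) 0 (SU N)) :
    (sect2ActionDataOfRecord F N V K S Rz s t a Ek).action23 1 U = -(1 / (S.flow.g 0) ^ 2 * wilsonAction4 U) - Ek :=
  action23_of_forall_Omega_empty S Rz hM s (fun j h1 h2 => by obtain rfl : j = 1 := le_antisymm h2 h1; exact hΩ) t a Ek U

end Generic

/-! ## §2. At the Stage-13 setting of record: `e^{A_1(s′)(U)} = e^{E(p) − E_1}·ρ₀(U)` -/

section AtRecord

variable (θ : Stage13Params F N) (p : B12.RunParams)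

/-- **`e^{A_1(s′)(U)} = e^{E(p) − E_1}·ρ₀(U)`** at the Stage-13 setting of record (`g_0 = g₀` of the run: `genSeq_zero`; `ρ₀ = e^{−E}e^{−g₀⁻²A}`), for every term-value
witness, at the all-large-field new sequence (`M ≥ 1`). [cite: Balaban1988Convergent, Thm 1 p.262, (2.23) p.258] -/
theorem exp_action23_one_eq_rhoZero_of_Omega_empty₁₃ (hM : 1 ≤ θ.τ9.M)
    (s : SeqOfRecord F θ.ν θ.τ9.M (gOfRecord₁₃ F N θ p) p.K 1) (hΩ : s.Ω 1 = ∅)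
    (t : Sect2.TermValues (F.P p.K) (MatA N) (FluctV N) θ.τ9.M) (a : Tk.SFluct (F.P p.K) (FluctV N)) (Ek : ℝ) (U : GaugeField (F.P p.K) 0 (SU N)) :
    Real.exp ((sect2ActionDataOfRecord F N (FluctV N) p.K (settingOfRecord₁₃ F N θ p) (θ.Rz p.K) s t a Ek).action23 1 U) =
      Real.exp (EOfRecord₁₃ F N θ p - Ek) * rhoZeroOfRecord F N p.K p.g0 (EOfRecord₁₃ F N θ p) U := by
  rw [action23_one_of_Omega_empty (settingOfRecord₁₃ F N θ p) (θ.Rz p.K) hM s hΩ t a Ek U, settingOfRecord₁₃_flow_g]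
  have h0 : gOfRecord₁₃ F N θ p 0 = p.g0 := FlowStepRuns.genSeq_zero _ _
  rw [h0, rhoZeroOfRecord, Missing.boltzmann, ← Real.exp_add, ← Real.exp_add]
  congr 1
  rw [inv_pow, one_div]
  ring

end AtRecord

/-! ## §3. THE TERM-FREE CLOSED FORM of the no-expansion integrand at a `θ` with `θ.Zt = ZtOfRecord` -/

section TermFree

variable (θ : Stage13Params F N) (p : B12.RunParams)

/-- **THE NO-EXPANSION INTEGRAND AT A STAGE-13 `θ` WITH K0b's RESIDUAL 𝐓-WEIGHTS IS TERM-FREE**: under the letters' junction and `M ≥ 1`, at the all-large-field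
new sequence, for EVERY term-value witness `(t, E_1)`,
`noExpIntegrand (WtOfRecord₁₃ θ p) (exp A_1(s′) at UbgOfRecord₁₃ θ p 1 s′) V₁ U = (#{Y})⁻¹ · χreg_0(T)(U,V₁) · (e^{E(p) − E_1} · ρ₀(U))`.
[cite: Balaban1988Convergent, (2.10) p.256, (2.18) p.257, (2.21)–(2.23) p.258, (3.16) p.268, Thm 1 p.262] -/
theorem noExpIntegrand_termFree_of_Zt_eq_ZtOfRecord (hZt : θ.Zt = ZtOfRecord F N)
    (hc : θ.s2.cR * epsOfRecord θ.ν (gOfRecord₁₃ F N θ p) 0 ≤ θ.ν.εreg * (F.P p.K).eta 0 ^ 2) (hM : 1 ≤ θ.τ9.M)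
    (s : SeqOfRecord F θ.ν θ.τ9.M (gOfRecord₁₃ F N θ p) p.K 1) (hΩ : s.Ω 1 = ∅)
    (t : Sect2.TermValues (F.P p.K) (MatA N) (FluctV N) θ.τ9.M) (Ek : ℝ) (V1 : GaugeField (F.P p.K) 1 (SU N)) (Uf : GaugeField (F.P p.K) 0 (SU N)) :
    noExpIntegrand F N (FluctV N) p.K (WtOfRecord₁₃ F N θ p)
        (sect2Operand F N (FluctV N) p.K (settingOfRecord₁₃ F N θ p) (θ.Rz p.K) s t Ek (UbgOfRecord₁₃ F N θ p 1 s)) V1 Uf =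
      ((Nat.card (Set (Site (F.P p.K) 0)) : ℝ))⁻¹ *
          chiRegW F N (FluctV N) θ.ν θ.s2.cR p (gOfRecord₁₃ F N θ p) 0 Set.univ (pairCfg (V := FluctV N) V1 Uf) *
        (Real.exp (EOfRecord₁₃ F N θ p - Ek) * rhoZeroOfRecord F N p.K p.g0 (EOfRecord₁₃ F N θ p) Uf) := by
  rw [noExpIntegrand_WtOfRecord₁₃_sect2Operand_of_Zt_eq_ZtOfRecord θ p hZt hc s hΩ t Ek V1 Uf,
    exp_action23_one_eq_rhoZero_of_Omega_empty₁₃ θ p hM s hΩ t _ Ek Uf]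

end TermFree

/-! ## §4. THE WEIGHTS-ONLY NECESSARY CONDITION that `TLaw₁₃ θ p 0` imposes at the all-large-field sequence — displayed provisos DISCHARGED -/

section NecessaryCondition

variable (θ : Stage13Params F N) (p : B12.RunParams)

/-- **The term-free integrand's variable part `(V₁, U) ↦ χreg_0(T)(U,V₁)·f(U)` is jointly measurable for measurable `f`** — p. 256's regularity factor at the
two-scale configuration reads only `U` (g3's `chiRegW_zero_pairCfg`) and is the indicator of the measurable small-plaquette event
(`T4AxialGaugeFixing.measurableSet_plaqSmallOn`). [cite: Balaban1988Convergent, (2.10) p.256 (bookkeeping)] -/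
theorem measurable_chiRegW_pairCfg_mul {f : GaugeField (F.P p.K) 0 (SU N) → ℝ} (hf : Measurable f) :
    Measurable (Function.uncurry fun (V1 : GaugeField (F.P p.K) 1 (SU N)) (Uf : GaugeField (F.P p.K) 0 (SU N)) =>
      chiRegW F N (FluctV N) θ.ν θ.s2.cR p (gOfRecord₁₃ F N θ p) 0 Set.univ (pairCfg (V := FluctV N) V1 Uf) * f Uf) := by
  show Measurable fun z : GaugeField (F.P p.K) 1 (SU N) × GaugeField (F.P p.K) 0 (SU N) =>
    chiRegW F N (FluctV N) θ.ν θ.s2.cR p (gOfRecord₁₃ F N θ p) 0 Set.univ (pairCfg (V := FluctV N) z.1 z.2) * f z.2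
  simp only [chiRegW_zero_pairCfg]
  exact (Measurable.ite (measurable_snd (T4AxialGaugeFixing.measurableSet_plaqSmallOn _ _)) measurable_const measurable_const).mul
    (hf.comp measurable_snd)

/-- **… and `|χreg_0(T)(U,V₁)·ρ₀(U)| ≤ e^{−E}`** (`χreg ∈ {0,1}`, `0 < ρ₀ ≤ e^{−E}`: K0b's `rhoZeroOfRecord_le`). [cite: Balaban1988Convergent, (2.10) p.256, Thm 1 p.262 (bookkeeping)] -/
theorem abs_chiRegW_pairCfg_mul_rhoZero_le (E : ℝ) (V1 : GaugeField (F.P p.K) 1 (SU N)) (Uf : GaugeField (F.P p.K) 0 (SU N)) :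
    |chiRegW F N (FluctV N) θ.ν θ.s2.cR p (gOfRecord₁₃ F N θ p) 0 Set.univ (pairCfg (V := FluctV N) V1 Uf) * rhoZeroOfRecord F N p.K p.g0 E Uf| ≤
      Real.exp (-E) := by
  rw [chiRegW_zero_pairCfg]
  split_ifs
  · rw [one_mul, abs_of_pos (rhoZeroOfRecord_pos F N p.K p.g0 E Uf)]
    exact rhoZeroOfRecord_le F N p.K p.g0 E Uf
  · rw [zero_mul, abs_zero]
    exact (Real.exp_pos _).le

/-- **WHAT `TLaw₁₃ θ p 0` DEMANDS AT THE ALL-LARGE-FIELD SEQUENCE OF A `θ` WITH `θ.Zt = ZtOfRecord` IS A WEIGHTS-ONLY EQUATION** (junction, `M ≥ 1`, `0 < K` — NO other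
proviso): if the first 𝐓-step law holds at `θ`, then for SOME constant `E_1` (the witness's), EITHER `slotT_1(s′) ≡ 0` OR, `dV₁`-a.e.,
`∫dU δ(ŪV₁⁻¹) w(s′)(U,V₁)·ρ₀(U) = ∫dU δ(ŪV₁⁻¹) (#{Y})⁻¹·χreg_0(T)(U,V₁)·e^{E−E_1}·ρ₀(U)` — def-T's (3.2)-weighted Wilson start against the regularity-cut Wilson start,
NO 𝐄-term, NO choice left but one constant.  (By transport duality: `E[ρ₀·(w(s′)(·,Ū) − (#{Y})⁻¹e^{E−E_1}·χreg_0(T)) | Ū] = 0` a.s.)  A NECESSARY CONDITION on the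
witness, read off the tree's objects; whether it holds at K0a's witnesses is NOT decided here. [cite: Balaban1988Convergent, Theorem p.245, (3.1)–(3.2) pp.264–265, (3.25) p.270, (2.10) p.256, (2.21)–(2.23) p.258, Thm 1 p.262] -/
theorem tLaw₁₃_zero_termFree_of_Zt_eq_ZtOfRecord (hZt : θ.Zt = ZtOfRecord F N)
    (hc : θ.s2.cR * epsOfRecord θ.ν (gOfRecord₁₃ F N θ p) 0 ≤ θ.ν.εreg * (F.P p.K).eta 0 ^ 2) (hM : 1 ≤ θ.τ9.M) (hK : 0 < p.K)
    (s : SeqOfRecord F θ.ν θ.τ9.M (gOfRecord₁₃ F N θ p) p.K 1) (hΩ : s.Ω 1 = ∅) (hT : TLaw₁₃ F N θ p 0) :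
    ∃ Ek : ℝ,
      slotsTOfRecord F N θ.ν θ.τ9 (EOfRecord₁₃ F N θ) (wOfRecord₉ F N θ.toStage9Params) θ.ppSel p
          (gOfRecord₁₃ F N θ p) 1 s = 0 ∨
        (fun V1 => transportOfRecord F N p.K 0 (fun U => wOfRecord₉ F N θ.toStage9Params p (gOfRecord₁₃ F N θ p) 0 s U V1 *
            rhoZeroOfRecord F N p.K (gOfRecord₁₃ F N θ p 0) (EOfRecord₁₃ F N θ p) U) V1)
          =ᵐ[fieldMeasure (F.P p.K) 1 (SU N)]
        fun V1 => transportOfRecord F N p.K 0 (fun Uf =>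
            ((Nat.card (Set (Site (F.P p.K) 0)) : ℝ))⁻¹ *
                chiRegW F N (FluctV N) θ.ν θ.s2.cR p (gOfRecord₁₃ F N θ p) 0 Set.univ (pairCfg (V := FluctV N) V1 Uf) *
              (Real.exp (EOfRecord₁₃ F N θ p - Ek) * rhoZeroOfRecord F N p.K p.g0 (EOfRecord₁₃ F N θ p) Uf)) V1 := by
  obtain ⟨t, Ekf, -, -, hcl⟩ := tLaw₁₃_zero_clause_of_Omega_empty θ p hT s hΩ
  refine ⟨Ekf s, ?_⟩
  -- the constant in front of `χreg·ρ₀` in the term-free integrand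
  set c : ℝ := ((Nat.card (Set (Site (F.P p.K) 0)) : ℝ))⁻¹ * Real.exp (EOfRecord₁₃ F N θ p - Ekf s) with hc_def
  have hm := measurable_chiRegW_pairCfg_mul θ p (measurable_rhoZeroOfRecord F N p.K p.g0 (EOfRecord₁₃ F N θ p))
  have hfun : (Function.uncurry fun (V1 : GaugeField (F.P p.K) 1 (SU N)) (Uf : GaugeField (F.P p.K) 0 (SU N)) =>
        ((Nat.card (Set (Site (F.P p.K) 0)) : ℝ))⁻¹ *
            chiRegW F N (FluctV N) θ.ν θ.s2.cR p (gOfRecord₁₃ F N θ p) 0 Set.univ (pairCfg (V := FluctV N) V1 Uf) *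
          (Real.exp (EOfRecord₁₃ F N θ p - Ekf s) * rhoZeroOfRecord F N p.K p.g0 (EOfRecord₁₃ F N θ p) Uf)) =
      fun z => c * (Function.uncurry (fun (V1 : GaugeField (F.P p.K) 1 (SU N)) (Uf : GaugeField (F.P p.K) 0 (SU N)) =>
        chiRegW F N (FluctV N) θ.ν θ.s2.cR p (gOfRecord₁₃ F N θ p) 0 Set.univ (pairCfg (V := FluctV N) V1 Uf) *
          rhoZeroOfRecord F N p.K p.g0 (EOfRecord₁₃ F N θ p) Uf) z) := by
    funext z
    rcases z with ⟨V1, Uf⟩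
    simp only [Function.uncurry_apply_pair, hc_def]
    ring
  -- measurability ∕ bound of the closed-form integrand of `…AtTheta13` §2 (= the term-free one, by §2 here)
  have hm' : Measurable (Function.uncurry fun (V1 : GaugeField (F.P p.K) 1 (SU N)) (Uf : GaugeField (F.P p.K) 0 (SU N)) =>
      ((Nat.card (Set (Site (F.P p.K) 0)) : ℝ))⁻¹ *
          chiRegW F N (FluctV N) θ.ν θ.s2.cR p (gOfRecord₁₃ F N θ p) 0 Set.univ (pairCfg (V := FluctV N) V1 Uf) *
        Real.exp ((sect2ActionDataOfRecord F N (FluctV N) p.K (settingOfRecord₁₃ F N θ p) (θ.Rz p.K) s (t s)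
          (fun _ => ∅, fun j => (pairCfg (V := FluctV N) V1 Uf j).2) (Ekf s)).action23 1 Uf)) := by
    simp only [exp_action23_one_eq_rhoZero_of_Omega_empty₁₃ θ p hM s hΩ]
    rw [hfun]
    exact hm.const_mul c
  have hC' : ∀ (V1 : GaugeField (F.P p.K) 1 (SU N)) (Uf : GaugeField (F.P p.K) 0 (SU N)),
      |((Nat.card (Set (Site (F.P p.K) 0)) : ℝ))⁻¹ *
          chiRegW F N (FluctV N) θ.ν θ.s2.cR p (gOfRecord₁₃ F N θ p) 0 Set.univ (pairCfg (V := FluctV N) V1 Uf) *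
        Real.exp ((sect2ActionDataOfRecord F N (FluctV N) p.K (settingOfRecord₁₃ F N θ p) (θ.Rz p.K) s (t s)
          (fun _ => ∅, fun j => (pairCfg (V := FluctV N) V1 Uf j).2) (Ekf s)).action23 1 Uf)| ≤ |c| * Real.exp (-EOfRecord₁₃ F N θ p) := by
    intro V1 Uf
    rw [exp_action23_one_eq_rhoZero_of_Omega_empty₁₃ θ p hM s hΩ (t s) _ (Ekf s) Uf]
    have : ((Nat.card (Set (Site (F.P p.K) 0)) : ℝ))⁻¹ *
          chiRegW F N (FluctV N) θ.ν θ.s2.cR p (gOfRecord₁₃ F N θ p) 0 Set.univ (pairCfg (V := FluctV N) V1 Uf) *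
        (Real.exp (EOfRecord₁₃ F N θ p - Ekf s) * rhoZeroOfRecord F N p.K p.g0 (EOfRecord₁₃ F N θ p) Uf) =
        c * (chiRegW F N (FluctV N) θ.ν θ.s2.cR p (gOfRecord₁₃ F N θ p) 0 Set.univ (pairCfg (V := FluctV N) V1 Uf) *
            rhoZeroOfRecord F N p.K p.g0 (EOfRecord₁₃ F N θ p) Uf) := by rw [hc_def]; ring
    rw [this, abs_mul]
    exact mul_le_mul_of_nonneg_left (abs_chiRegW_pairCfg_mul_rhoZero_le θ p _ V1 Uf) (abs_nonneg _)
  have h := tLaw₁₃_zero_coherence_of_Zt_eq_ZtOfRecord θ p hZt hc hK s hΩ (t s) (Ekf s) hcl hm' hC'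
  simp only [exp_action23_one_eq_rhoZero_of_Omega_empty₁₃ θ p hM s hΩ] at h
  exact h

end NecessaryCondition

/-! ### §4b. At K0a's witnesses (junction discharged for every `ε₀`, `g₀ ≥ 0`; `M = 1`) — NO displayed proviso left but `0 ≤ g₀`, `0 < K` -/

section AtWitness

variable (F N)
variable (ε₀ : ℝ) (ζ : ZetaOfRecord F N (numerics7OfFamily ε₀) 1) (Rz : (K : ℕ) → Sect2.Residual (F.P K) (MatA N))

/-- `θ₁₃`'s tower numerics have cube side `M = 1` (`rfl`). [cite: Balaban1989LargeFieldI, (2.1) p.182 (bookkeeping witness)] -/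
theorem one_le_M_theta13LiveOfFamily (Zt : (K : ℕ) → TkResidualW F N (FluctV N) K) :
    1 ≤ (theta13LiveOfFamily F N ε₀ ζ Rz Zt).τ9.M :=
  le_of_eq (theta12OfFamilyL_τ9_M F N ε₀ ζ Rz Zt).symm

/-- **THE WEIGHTS-ONLY NECESSARY CONDITION AT K0a's STAGE-13 WITNESS OF THE FAMILY** `theta13LiveOfFamily ε₀ ζ Rz ZtOfRecord` (every `ε₀`, `ζ`, `Rz`; `0 ≤ g₀`,
`0 < K`): if `TLaw₁₃ θ p 0` holds there, then for some constant `E_1` the all-large-field pre-𝐑 slot is `≡ 0` or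
`T[w(s′)(·,V₁)·ρ₀] =ᵐ T[(#{Y})⁻¹·e^{E−E_1}·χreg_0(T)(·,V₁)·ρ₀]`. [cite: Balaban1988Convergent, Theorem p.245, (3.25) p.270, (2.10) p.256, (2.21)–(2.23) p.258] -/
theorem tLaw₁₃_zero_termFree_theta13LiveOfFamily (p : B12.RunParams) (hg : 0 ≤ p.g0) (hK : 0 < p.K)
    (s : SeqOfRecord F (theta13LiveOfFamily F N ε₀ ζ Rz (ZtOfRecord F N)).ν (theta13LiveOfFamily F N ε₀ ζ Rz (ZtOfRecord F N)).τ9.M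
      (gOfRecord₁₃ F N (theta13LiveOfFamily F N ε₀ ζ Rz (ZtOfRecord F N)) p) p.K 1) (hΩ : s.Ω 1 = ∅)
    (hT : TLaw₁₃ F N (theta13LiveOfFamily F N ε₀ ζ Rz (ZtOfRecord F N)) p 0) :
    ∃ Ek : ℝ,
      slotsTOfRecord F N (theta13LiveOfFamily F N ε₀ ζ Rz (ZtOfRecord F N)).ν (theta13LiveOfFamily F N ε₀ ζ Rz (ZtOfRecord F N)).τ9
          (EOfRecord₁₃ F N (theta13LiveOfFamily F N ε₀ ζ Rz (ZtOfRecord F N)))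
          (wOfRecord₉ F N (theta13LiveOfFamily F N ε₀ ζ Rz (ZtOfRecord F N)).toStage9Params)
          (theta13LiveOfFamily F N ε₀ ζ Rz (ZtOfRecord F N)).ppSel p
          (gOfRecord₁₃ F N (theta13LiveOfFamily F N ε₀ ζ Rz (ZtOfRecord F N)) p) 1 s = 0 ∨
        (fun V1 => transportOfRecord F N p.K 0 (fun U =>
            wOfRecord₉ F N (theta13LiveOfFamily F N ε₀ ζ Rz (ZtOfRecord F N)).toStage9Params p
                (gOfRecord₁₃ F N (theta13LiveOfFamily F N ε₀ ζ Rz (ZtOfRecord F N)) p) 0 s U V1 *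
              rhoZeroOfRecord F N p.K (gOfRecord₁₃ F N (theta13LiveOfFamily F N ε₀ ζ Rz (ZtOfRecord F N)) p 0)
                (EOfRecord₁₃ F N (theta13LiveOfFamily F N ε₀ ζ Rz (ZtOfRecord F N)) p) U) V1)
          =ᵐ[fieldMeasure (F.P p.K) 1 (SU N)]
        fun V1 => transportOfRecord F N p.K 0 (fun Uf =>
            ((Nat.card (Set (Site (F.P p.K) 0)) : ℝ))⁻¹ *
                chiRegW F N (FluctV N) (theta13LiveOfFamily F N ε₀ ζ Rz (ZtOfRecord F N)).ν (theta13LiveOfFamily F N ε₀ ζ Rz (ZtOfRecord F N)).s2.cR p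
                  (gOfRecord₁₃ F N (theta13LiveOfFamily F N ε₀ ζ Rz (ZtOfRecord F N)) p) 0 Set.univ (pairCfg (V := FluctV N) V1 Uf) *
              (Real.exp (EOfRecord₁₃ F N (theta13LiveOfFamily F N ε₀ ζ Rz (ZtOfRecord F N)) p - Ek) *
                rhoZeroOfRecord F N p.K p.g0 (EOfRecord₁₃ F N (theta13LiveOfFamily F N ε₀ ζ Rz (ZtOfRecord F N)) p) Uf)) V1 :=
  tLaw₁₃_zero_termFree_of_Zt_eq_ZtOfRecord _ p (Zt_theta13LiveOfFamily F N ε₀ ζ Rz (ZtOfRecord F N))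
    (lettersJunction_theta13LiveOfFamily F N ε₀ ζ Rz (ZtOfRecord F N) p hg) (one_le_M_theta13LiveOfFamily F N ε₀ ζ Rz (ZtOfRecord F N))
    hK s hΩ hT

/-- **… AND AT THE WITNESS OF RECORD `theta13LiveOfRecord`** (`ε₀ := 1`, K0b's `ζ`, `Rz`, `Zt` of record): the weights-only necessary condition that K1‴'s N11 conjunct
imposes there at its first step — hypotheses `0 ≤ g₀`, `0 < K` and `TLaw₁₃` only. [cite: Balaban1988Convergent, Theorem p.245, (3.25) p.270, (2.10) p.256, (2.21)–(2.23) p.258] -/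
theorem tLaw₁₃_zero_termFree_theta13LiveOfRecord (p : B12.RunParams) (hg : 0 ≤ p.g0) (hK : 0 < p.K)
    (s : SeqOfRecord F (theta13LiveOfRecord F N).ν (theta13LiveOfRecord F N).τ9.M (gOfRecord₁₃ F N (theta13LiveOfRecord F N) p) p.K 1)
    (hΩ : s.Ω 1 = ∅) (hT : TLaw₁₃ F N (theta13LiveOfRecord F N) p 0) :
    ∃ Ek : ℝ,
      slotsTOfRecord F N (theta13LiveOfRecord F N).ν (theta13LiveOfRecord F N).τ9 (EOfRecord₁₃ F N (theta13LiveOfRecord F N))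
          (wOfRecord₉ F N (theta13LiveOfRecord F N).toStage9Params) (theta13LiveOfRecord F N).ppSel p
          (gOfRecord₁₃ F N (theta13LiveOfRecord F N) p) 1 s = 0 ∨
        (fun V1 => transportOfRecord F N p.K 0 (fun U =>
            wOfRecord₉ F N (theta13LiveOfRecord F N).toStage9Params p (gOfRecord₁₃ F N (theta13LiveOfRecord F N) p) 0 s U V1 *
              rhoZeroOfRecord F N p.K (gOfRecord₁₃ F N (theta13LiveOfRecord F N) p 0) (EOfRecord₁₃ F N (theta13LiveOfRecord F N) p) U) V1)
          =ᵐ[fieldMeasure (F.P p.K) 1 (SU N)]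
        fun V1 => transportOfRecord F N p.K 0 (fun Uf =>
            ((Nat.card (Set (Site (F.P p.K) 0)) : ℝ))⁻¹ *
                chiRegW F N (FluctV N) (theta13LiveOfRecord F N).ν (theta13LiveOfRecord F N).s2.cR p
                  (gOfRecord₁₃ F N (theta13LiveOfRecord F N) p) 0 Set.univ (pairCfg (V := FluctV N) V1 Uf) *
              (Real.exp (EOfRecord₁₃ F N (theta13LiveOfRecord F N) p - Ek) *
                rhoZeroOfRecord F N p.K p.g0 (EOfRecord₁₃ F N (theta13LiveOfRecord F N) p) Uf)) V1 :=
  tLaw₁₃_zero_termFree_theta13LiveOfFamily F N eps0OfRecord₁₃ _ _ p hg hK s hΩ hT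

end AtWitness

end Summit.QuantumFields.YangMills.Theorems.BalabanUVNodesN11NoExpansionTermFree

end
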